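import Literature.Analysis.FluidPDE.NavierStokesConcentrationCorrector
import HarnessLib

/-!
# The Cheskidov–Luo corrector fact, decomposed: local solvability of (3.2) and the heat-flow antidivergence bound

A. Cheskidov, X. Luo, *Sharp nonuniqueness for the Navier–Stokes equations*, Invent. Math. 229
(2022) 987–1054 = arXiv:2009.06596, §3.1 and Prop. 3.2. The named fact
`Torus.CheskidovLuo2022Corrector` (`NavierStokesConcentrationCorrector`) packages two analytically
distinct inputs of the concentration step, which this file separates so that they can be
discharged independently (D-0014, bottom-up):

* `Torus.IsLinearizedNSSolutionOn u R a b v q` — the PDE clauses of `Torus.IsCorrector`: `(v, q)`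
  is a smooth solution on `[a, b] × 𝕋^d` of the generalised Navier–Stokes system (3.2) linearised
  around `u` and forced by `-div R`, `∂ₜv + (v·∇)v + (u·∇)v + (v·∇)u + ∇q = Δv - div R`,
  `div v = 0`, `v(a) = 0`, with `v(t)`, `q(t)` of zero mean.
* `Torus.CheskidovLuo2022LocalExistence` (named fact) — CL22 §3.1 ("thanks to the general local
  wellposedness theory of the Navier–Stokes equations … for all sufficiently small `τ > 0`, we may
  solve equation (3.2) on intervals `[tᵢ, tᵢ₊₁]` to obtain a unique smooth solution `vᵢ`") together
  with the first estimate of Prop. 3.2 (`‖vᵢ‖_{L^∞([tᵢ,tᵢ₊₁];H^d)} ≤ δ` for `τ` small, rendered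
  through `H^d(𝕋^d) ↪ L^∞` as the pointwise bound `‖vᵢ(t, x)‖ ≤ δ`, the form consumed downstream):
  on every interval of a sufficiently fine uniform grid of `[0, T]` the system has a smooth
  solution of sup norm `≤ δ`, uniformly in the position of the interval.
* `Torus.CheskidovLuo2022AntidivergenceBound` (named fact) — the second estimate of Prop. 3.2 in
  **heat-flow form**: a smooth solution `v` of (3.2) on `[a, b]` with `sup ‖v‖ ≤ δ` is
  `v = div A + ∇π` with `A` smooth, symmetric, trace free and
  `‖A(t)‖_{L^r} ≤ C ∫ₐᵇ ‖R‖_{L^r} + C (δ + sup ‖u‖) δ (b - a)`, `C = C_r`. Print proves this for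
  `A = ℛvᵢ` (`π = 0`) from the heat equation `∂ₜz - Δz = F` for `z = ℛvᵢ` and the Calderón–Zygmund
  bound for `ℛℙdiv` on `L^r(𝕋^d)`; since `Torus.IsCorrector` allows a gradient part, the same
  heat-flow argument applies to the Duhamel solution `A` of `∂ₜA - ΔA = -S̊`, `A(a) = 0`, where
  `S̊` is the traceless part of the symmetric tensor `R + v ⊗ v + v ⊗ u + u ⊗ v` (so that
  `div S̊ = div R + (v·∇)v + (u·∇)v + (v·∇)u - ∇(tr S/d)` for divergence-free `u`, `v`), and needs
  only the `L^r`-accretivity of the heat flow (energy method for `∂ₜθ = Δθ + g`: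
  `‖θ(t)‖_r ≤ ∫ₐᵗ ‖g‖_r`), no singular integrals; the gradient part `∇π` collects `∇q`, `∇(tr S/d)`
  and the Helmholtz correction. This is the statement to be DISCHARGED (from the classical
  well-posedness of the forced heat equation on `𝕋^d`,
  `Torus.exists_unique_isClassicalScalarTransportForcedOn`, plus the energy estimate), whence it
  is recorded with the printed quantifier order (`C = C_r` chosen after `1 < r < ∞`; the heat-flow
  proof in fact gives `C` depending on `d` only).
* `Torus.CheskidovLuo2022Corrector.of_localExistence_of_antidivergenceBound` (proved) — the two
  facts imply `Torus.CheskidovLuo2022Corrector` (bookkeeping: `C := C_r`, `C_u := C (1 + sup ‖u‖)`,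
  `δ₀ := 1`, the grid threshold from the local existence fact).

## Mathlib / tree search

No local existence theorem for (forced or unforced) Navier–Stokes on `UnitAddTorus` in the tree
(`lean search 'Corrector|wellposed|IsClassicalNSSolutionOn|LocalExistence'`); whole space:
`NSFourier*` (proved, unforced), `TaoH1LocalExistence` (fact). The scalar twin on the torus,
`Torus.exists_unique_isClassicalScalarTransportForcedOn` (`PassiveScalarWellPosedness`), has been
discharged on the Fourier side (`ScalarFourierDefs` … `PassiveScalarWellPosednessProofs`); the
vector-valued construction for (3.2) will reuse that lattice machinery.

## References

* A. Cheskidov, X. Luo, *Sharp nonuniqueness for the Navier–Stokes equations*, Invent. Math. 229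
  (2022), 987–1054; arXiv:2009.06596: §3.1 (3.2) and the paragraph following it, Prop. 3.2 and
  its proof (arXiv p. 14–15). [`CheskidovLuo2022`]
* A. J. Majda, A. L. Bertozzi, *Vorticity and Incompressible Flow*, CUP 2002, Thm. 3.4 (local
  `H^m` theory, the "general local wellposedness theory" invoked in §3.1). [`MajdaBertozzi2002`]
-/

open MeasureTheory Set Filter
open scoped InnerProductSpace ContDiff ENNReal NNReal

noncomputable section

namespace Literature.Analysis.FluidPDE

namespace Torus

variable {d : Type*} [Fintype d] [DecidableEq d]

/-- **Smooth solutions of the linearised, stress-forced Navier–Stokes system (3.2) on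
`[a, b] × 𝕋^d`** (Cheskidov–Luo 2022, §3.1: "`∂ₜvᵢ - Δvᵢ + div(vᵢ ⊗ vᵢ) + div(vᵢ ⊗ u) + div(u ⊗ vᵢ)
+ ∇qᵢ = -div R`, `div vᵢ = 0`, `vᵢ(tᵢ) = 0`"), exactly the PDE clauses of `Torus.IsCorrector`:
`v`, `q` jointly `C^∞` on `[a, b] × 𝕋^d` (one-sided in time at the endpoints); the momentum
equation in convective form `∂ₜv + (v·∇)v + (u·∇)v + (v·∇)u + ∇q = Δv - div R` with the one-sided
time derivative within `[a, b]` (for divergence-free `u`, `v` this is the printed divergence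
form); `div v = 0`; `v(a) = 0`; `v(t)` and `q(t)` of zero mean ("(3.2) preserves the zero-mean
condition"; the pressure normalisation is free). [cite: CheskidovLuo2022, §3.1 (3.2)] -/
structure IsLinearizedNSSolutionOn (u : ℝ → UnitAddTorus d → EuclideanSpace ℝ d)
    (R : ℝ → UnitAddTorus d → d → EuclideanSpace ℝ d) (a b : ℝ)
    (v : ℝ → UnitAddTorus d → EuclideanSpace ℝ d) (q : ℝ → UnitAddTorus d → ℝ) : Prop where
  /-- The velocity corrector is jointly smooth on `[a, b] × 𝕋^d`. -/
  smooth_v : FunctionSpaces.Torus.IsSmoothSpaceTimeOn (Icc a b) v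
  /-- The pressure corrector is jointly smooth on `[a, b] × 𝕋^d`. -/
  smooth_q : FunctionSpaces.Torus.IsSmoothSpaceTimeOn (Icc a b) q
  /-- System (3.2) in convective form, with the one-sided time derivative within `[a, b]`. -/
  momentum : ∀ t ∈ Icc a b, ∀ x,
    FunctionSpaces.Torus.timeDerivWithin (Icc a b) v t x +
          FunctionSpaces.Torus.convect (v t) (v t) x + FunctionSpaces.Torus.convect (u t) (v t) x +
          FunctionSpaces.Torus.convect (v t) (u t) x +
        FunctionSpaces.Torus.gradient (q t) x =
      FunctionSpaces.Torus.laplacian (v t) x - tensorDivergence (R t) x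
  /-- `div v(t) = 0`. -/
  divFree : ∀ t ∈ Icc a b, FunctionSpaces.Torus.IsDivFree (v t)
  /-- Zero initial datum `v(a) = 0`. -/
  initial : ∀ x, v a x = 0
  /-- `v(t)` has zero mean. -/
  hasZeroMean_v : ∀ t ∈ Icc a b, FunctionSpaces.Torus.HasZeroMean (v t)
  /-- `q(t)` has zero mean. -/
  hasZeroMean_q : ∀ t ∈ Icc a b, FunctionSpaces.Torus.HasZeroMean (q t)

/-- The PDE clauses of a corrector form a linearised solution (projection). [cite: CheskidovLuo2022, §3.1 (3.2)] -/
theorem IsCorrector.isLinearizedNSSolutionOn {u : ℝ → UnitAddTorus d → EuclideanSpace ℝ d}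
    {R : ℝ → UnitAddTorus d → d → EuclideanSpace ℝ d} {r C K δ a b : ℝ}
    {v : ℝ → UnitAddTorus d → EuclideanSpace ℝ d} {q : ℝ → UnitAddTorus d → ℝ}
    {A : ℝ → UnitAddTorus d → d → EuclideanSpace ℝ d} {π : ℝ → UnitAddTorus d → ℝ}
    (h : IsCorrector u R r C K δ a b v q A π) : IsLinearizedNSSolutionOn u R a b v q :=
  ⟨h.smooth_v, h.smooth_q, h.momentum, h.divFree, h.initial, h.hasZeroMean_v, h.hasZeroMean_q⟩

/-- **The zero solution.** Where the stress vanishes identically on `[a, b] × 𝕋^d`, `(v, q) = 0`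
solves (3.2) (CL22, §3.3: "`vᵢ ≡ 0` for `i` such that `R ≡ 0` on `[tᵢ, tᵢ₊₁]`").
[cite: CheskidovLuo2022, §3.3] -/
theorem IsLinearizedNSSolutionOn.zero {u : ℝ → UnitAddTorus d → EuclideanSpace ℝ d}
    {R : ℝ → UnitAddTorus d → d → EuclideanSpace ℝ d} {a b : ℝ}
    (hR : ∀ t ∈ Icc a b, ∀ x, R t x = 0) :
    IsLinearizedNSSolutionOn u R a b (fun _ _ => 0) (fun _ _ => 0) :=
  (IsCorrector.zero (r := 0) (C := 0) (K := 0) le_rfl hR).isLinearizedNSSolutionOn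

/-- **Cheskidov–Luo 2022, §3.1 with Prop. 3.2 (first estimate): local smooth solvability of
(3.2) on fine grids, named fact.** Printed (viscosity `1`, `d ≥ 2`, `T = 1`, `tᵢ = iτ^ε`,
`0 ≤ i ≤ τ^{-ε} - 1`, "we assume `τ^{-ε}` is always an integer"): "Since the initial data for `vᵢ`
is zero and `u` and `R` are smooth on `[0,1] × 𝕋^d`, thanks to the general local wellposedness
theory of the Navier–Stokes equations …, for all sufficiently small `τ > 0`, we may solve equation
(3.2) on intervals `t ∈ [tᵢ, tᵢ₊₁]` to obtain a unique smooth solution `vᵢ`", and Prop. 3.2: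
"For any `δ > 0`, if `τ > 0` is sufficiently small, then the unique smooth solutions `vᵢ` to (3.2)
on `[tᵢ, tᵢ₊₁]` satisfies `‖vᵢ‖_{L^∞([tᵢ,tᵢ₊₁]; H^d(𝕋^d))} ≤ δ`" (proof: "uniform equicontinuity
of solutions on bounded sets of `H^d` and the fact that `‖u‖_{H^d}` is bounded on `[0,1]`").
**Rendering.** `card d ≥ 2`; background `Torus.IsNSReynoldsOn (Icc 0 T) 1 u P R`, `T > 0`; grid
`tᵢ = iT/n`, `0 ≤ i < n`, for all `n ≥ n₀(δ, background)`; conclusion: a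
`Torus.IsLinearizedNSSolutionOn u R tᵢ tᵢ₊₁ v q` pair with the pointwise bound `‖v(t, x)‖ ≤ δ`
(the `H^d`-bound through `H^d(𝕋^d) ↪ L^∞`, the form used by the gluing of §3.2 and by
`Torus.CheskidovLuo2022AntidivergenceBound`). Uniqueness is not recorded (unused downstream).
The proof (mild formulation on the Fourier side, Picard iteration in weighted sup-norms on
intervals of length `T/n` — short enough that the forcing `-ℙ div R = O(1)` produces a solution of
size `O(√(T/n)) ≤ δ` and the quadratic and linear terms are perturbative, uniformly in `i` by the
smoothness of `u`, `R` on the compact `[0, T] × 𝕋^d` — then bootstrap of all polynomial decays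
and of all time derivatives on the same interval, synthesis of a jointly smooth field, cf. the
tree's `NSFourierPicard`/`ScalarFourierPicard`; classically Majda–Bertozzi 2002, Thm. 3.4) is
not formalised here. [cite: CheskidovLuo2022, §3.1 (3.2) and Prop. 3.2] -/
def CheskidovLuo2022LocalExistence : Prop :=
  2 ≤ Fintype.card d → ∀ (T : ℝ), 0 < T →
    ∀ (u : ℝ → UnitAddTorus d → EuclideanSpace ℝ d) (P : ℝ → UnitAddTorus d → ℝ)
      (R : ℝ → UnitAddTorus d → d → EuclideanSpace ℝ d),
      IsNSReynoldsOn (Icc 0 T) 1 u P R →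
      ∀ (δ : ℝ), 0 < δ → ∃ n₀ : ℕ, 0 < n₀ ∧ ∀ (n : ℕ), n₀ ≤ n → ∀ (i : ℕ), i < n →
        ∃ (v : ℝ → UnitAddTorus d → EuclideanSpace ℝ d) (q : ℝ → UnitAddTorus d → ℝ),
          IsLinearizedNSSolutionOn u R (i * (T / n)) ((i + 1) * (T / n)) v q ∧
            ∀ t ∈ Icc (i * (T / n) : ℝ) ((i + 1) * (T / n)), ∀ x, ‖v t x‖ ≤ δ

/-- **Cheskidov–Luo 2022, Prop. 3.2 (second estimate), heat-flow form, named fact.** Printed: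
"`‖ℛvᵢ‖_{L^∞([tᵢ,tᵢ₊₁]; L^r(𝕋^d))} ≤ C_r ∫_{[tᵢ,tᵢ₊₁]} ‖R(t)‖_{L^r} dt + C_u δ τ^ε`, where `C_u` is
a sufficiently large constant depending on `u` but not `δ` or `τ`"; proof: "`∂ₜz - Δz = F`,
`F = -ℛℙdiv(v ⊗ v + u ⊗ v + v ⊗ u) - ℛℙdiv R` … a standard energy method yields
`‖z(t)‖_{L^r} ≤ C_r ∫_{tᵢ}^t (‖R(s)‖_r + ‖v⊗v‖_r + ‖u⊗v‖_r + ‖v⊗u‖_r) ds` …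
`≤ C_r ∫ ‖R‖_r + C_r τ^ε δ (δ + ‖u‖_{L^∞_{t,x}})`".
**Rendering (the statement the heat-flow proof gives, for the antidivergence-with-gradient-part
of `Torus.IsCorrector`, with the printed dependence `C = C_r`).** `card d ≥ 2`; for every
`1 < r < ∞` there is `C > 0` such that: for `a < b`, a divergence-free drift `u` jointly smooth on `[a, b] × 𝕋^d` with `‖u‖ ≤ M`, a symmetric
stress `R` jointly smooth on `[a, b] × 𝕋^d`, and a solution `Torus.IsLinearizedNSSolutionOn u R a b v q`
with `‖v(t, x)‖ ≤ δ`, there are `A`, `π` jointly smooth on `[a, b] × 𝕋^d`, `π(t)` of zero mean,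
`A(t)` symmetric and trace free, with `v = div A + ∇π` on `[a, b]` and
`‖A(t)‖_{L^r} ≤ C ∫ₐᵇ ‖R(s)‖_{L^r} ds + C (δ + M) δ (b - a)` (`t ∈ [a, b]`; `L^r = eLpNorm · r` of
the slices, stress by columns with the column-sup pointwise norm, as in `Torus.IsCorrector`).
Here `A` is the solution of `∂ₜA - ΔA = -S̊`, `A(a) = 0`, `S̊` the traceless part of
`R + v ⊗ v + v ⊗ u + u ⊗ v`, and the bound is the `L^r`-accretivity of the heat flow
(`‖A(t)‖_r ≤ ∫ₐᵗ ‖S̊‖_r`, `‖S̊‖_r ≲_d ‖R‖_r + δ² + 2Mδ`); the printed `z = ℛvᵢ` (no gradient part)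
needs in addition the Calderón–Zygmund bound for `ℛℙdiv` ("`C_r` depends only on `r > 1` and
dimension `d`"). To be discharged from `Torus.exists_unique_isClassicalScalarTransportForcedOn` (forced heat equation on
`𝕋^d`) and the energy estimate. [cite: CheskidovLuo2022, Prop. 3.2 (second estimate and its proof)] -/
def CheskidovLuo2022AntidivergenceBound : Prop :=
  2 ≤ Fintype.card d → ∀ (r : ℝ), 1 < r → ∃ C : ℝ, 0 < C ∧ ∀ (a b : ℝ), a < b →
    ∀ (u : ℝ → UnitAddTorus d → EuclideanSpace ℝ d) (R : ℝ → UnitAddTorus d → d → EuclideanSpace ℝ d)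
      (v : ℝ → UnitAddTorus d → EuclideanSpace ℝ d) (q : ℝ → UnitAddTorus d → ℝ) (M δ : ℝ),
      FunctionSpaces.Torus.IsSmoothSpaceTimeOn (Icc a b) u →
      (∀ t ∈ Icc a b, FunctionSpaces.Torus.IsDivFree (u t)) →
      (∀ t ∈ Icc a b, ∀ x, ‖u t x‖ ≤ M) →
      FunctionSpaces.Torus.IsSmoothSpaceTimeOn (Icc a b) R →
      (∀ t ∈ Icc a b, ∀ x, ∀ i j : d, R t x i j = R t x j i) →
      IsLinearizedNSSolutionOn u R a b v q →
      (∀ t ∈ Icc a b, ∀ x, ‖v t x‖ ≤ δ) →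
      ∃ (A : ℝ → UnitAddTorus d → d → EuclideanSpace ℝ d) (π : ℝ → UnitAddTorus d → ℝ),
        FunctionSpaces.Torus.IsSmoothSpaceTimeOn (Icc a b) A ∧
        FunctionSpaces.Torus.IsSmoothSpaceTimeOn (Icc a b) π ∧
        (∀ t ∈ Icc a b, FunctionSpaces.Torus.HasZeroMean (π t)) ∧
        (∀ t ∈ Icc a b, ∀ x, ∀ i j : d, A t x i j = A t x j i) ∧
        (∀ t ∈ Icc a b, ∀ x, ∑ i, A t x i i = 0) ∧
        (∀ t ∈ Icc a b, ∀ x,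
          v t x = tensorDivergence (A t) x + FunctionSpaces.Torus.gradient (π t) x) ∧
        ∀ t ∈ Icc a b,
          eLpNorm (A t) (ENNReal.ofReal r) volume ≤
            ENNReal.ofReal (C * (∫ s in a..b, (eLpNorm (R s) (ENNReal.ofReal r) volume).toReal) +
              C * ((δ + M) * δ * (b - a)))

/-- **Assembly: the two facts give the corrector fact.** With `C := C_r` from the antidivergence
bound, `M := sup_{[0,T] × 𝕋^d} ‖u‖` (compactness), `C_u := C (1 + M)`, `δ₀ := 1` and the grid
threshold `n₀(δ)` of the local existence fact, each grid interval `[iT/n, (i+1)T/n]` carries a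
solution of (3.2) of sup norm `≤ δ`, and its heat-flow antidivergence obeys
`‖A(t)‖_{L^r} ≤ C ∫ ‖R‖_{L^r} + C (δ + M) δ (T/n) ≤ C ∫ ‖R‖_{L^r} + C_u δ (T/n)` because `δ ≤ 1`
(CL22, proof of Prop. 3.2: "`C_u` is a sufficiently large constant depending on `u` but not `δ`
or `τ`"). [cite: CheskidovLuo2022, §3.1 (3.2) and Prop. 3.2] -/
theorem CheskidovLuo2022Corrector.of_localExistence_of_antidivergenceBound
    (h₁ : CheskidovLuo2022LocalExistence (d := d))
    (h₂ : CheskidovLuo2022AntidivergenceBound (d := d)) : CheskidovLuo2022Corrector (d := d) := by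
  intro hd r hr
  obtain ⟨C, hC, H₂⟩ := h₂ hd r hr
  refine ⟨C, hC, fun T hT u P R hNSR => ?_⟩
  -- a uniform bound `M ≥ 0` for the background velocity on `[0, T] × 𝕋^d`
  obtain ⟨M₀, hM₀⟩ :=
    hNSR.smooth_velocity.exists_norm_le_of_isCompact isCompact_Icc Subset.rfl
  set M : ℝ := max M₀ 0 with hM_def
  have hM : ∀ t ∈ Icc 0 T, ∀ x, ‖u t x‖ ≤ M := fun t ht x => (hM₀ t ht x).trans (le_max_left _ _)
  have hM0 : 0 ≤ M := le_max_right _ _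
  refine ⟨C * (1 + M), 1, by positivity, one_pos, fun δ hδ hδ₁ => ?_⟩
  obtain ⟨n₀, hn₀, H₁⟩ := h₁ hd T hT u P R hNSR δ hδ
  refine ⟨n₀, hn₀, fun n hn i hi => ?_⟩
  obtain ⟨v, q, hsol, hsmall⟩ := H₁ n hn i hi
  -- the grid interval `[a, b] = [iT/n, (i+1)T/n] ⊆ [0, T]`
  set a : ℝ := i * (T / n) with ha_def
  set b : ℝ := (i + 1) * (T / n) with hb_def
  have hn_pos : (0 : ℝ) < n := by exact_mod_cast hn₀.trans_le hn
  have hTn : 0 < T / n := div_pos hT hn_pos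
  have hab : a < b := by
    rw [ha_def, hb_def]
    nlinarith
  have hba : b - a = T / n := by rw [ha_def, hb_def]; ring
  have ha0 : 0 ≤ a := by rw [ha_def]; positivity
  have hbT : b ≤ T := by
    have hi1 : (i : ℝ) + 1 ≤ n := by exact_mod_cast Nat.succ_le_of_lt hi
    calc b = (i + 1) * (T / n) := hb_def
      _ ≤ n * (T / n) := mul_le_mul_of_nonneg_right hi1 hTn.le
      _ = T := mul_div_cancel₀ T hn_pos.ne'
  have hsub : Icc a b ⊆ Icc 0 T := Icc_subset_Icc ha0 hbT
  obtain ⟨A, π, hA, hπ, hπ0, hsymm, htr, hdiv, hLr⟩ :=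
    H₂ a b hab u R v q M δ (hNSR.smooth_velocity.mono hsub)
      (fun t ht => hNSR.divFree t (hsub ht)) (fun t ht x => hM t (hsub ht) x)
      (hNSR.smooth_stress.mono hsub) (fun t ht => hNSR.symm t (hsub ht)) hsol hsmall
  refine ⟨v, q, A, π, ?_⟩
  exact
    { smooth_v := hsol.smooth_v
      smooth_q := hsol.smooth_q
      smooth_A := hA
      smooth_π := hπ
      momentum := hsol.momentum
      divFree := hsol.divFree
      initial := hsol.initial
      hasZeroMean_v := hsol.hasZeroMean_v
      hasZeroMean_q := hsol.hasZeroMean_q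
      hasZeroMean_π := hπ0
      symm := hsymm
      traceFree := htr
      eq_div_add_grad := hdiv
      norm_le := hsmall
      eLpNorm_le := fun t ht => by
        refine (hLr t ht).trans (ENNReal.ofReal_le_ofReal ?_)
        rw [hba]
        have hδ1M : (δ + M) * δ * (T / n) ≤ (1 + M) * δ * (T / n) := by
          have h1 : δ + M ≤ 1 + M := by linarith
          have h2 : 0 ≤ δ * (T / n) := by positivity
          nlinarith
        nlinarith [mul_le_mul_of_nonneg_left hδ1M hC.le] }

end Torus

end Literature.Analysis.FluidPDE
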